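import Summits.Ventures.CertifiedArithmetic.LowPrec.GemmThetaLawGenDefs

/-!
# Letter-dependent symbolic θ-certificates: soundness of the coverage check

HONEST FRAMING (venture CertifiedArithmetic / cell `pub-lowprec`, seat gemm, gen 12 → 13): certified
error envelopes and provably optimal rounding/accumulation schemes for low-precision formats under
stated cost models; every table by two implementations; no hardware or vendor claims.

Step (S4) of the soundness chain for `GemmThetaLawGenDefs.lean` (cell HANDOFF decision 35;
`code/gemm/thetalaw/GENDEFS-CONTRACT.md` §6): `LawData.coverOK lev sgn q = true` implies that for
every admissible `K` (`K ≥ K₀`, `= K₀` if `fixed`) and every trailing significand `t` in the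
level's range `[tlo(K), thi(K)]` (`t = 0` on the top) some served class `c ∈ mainClasses lev sgn q`
has a parameter `T` with `(K, T) ∈ c.dom` and `c.g·T + c.π = t` (`coverOK_sound`).  Ingredients:
the shape of a class domain (`mkDom_shape`, `classesFor_mem`: `K₀`, `fixed` of the law, a genuine
`T`-interval, `π < g`), the meaning of the `s`-interval of a class (`sIv_sound`, `t = 4s + r`) and
`coverChain_sound` of `GemmThetaLawCover.lean`.  Nothing about `mkDom`'s interval arithmetic needs
to be proved: coverage is what the chain criterion checks.
-/

namespace Literature.ComputerArithmetic.FloatingPoint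

namespace MiniFloat

namespace ThetaLaw

namespace LawData

variable (L : LawData)

open AForm

/-- SHAPE OF A CLASS DOMAIN: the law's `K₀` and `fixed`, and a `T`-interval. [cell] -/
theorem mkDom_shape {lev : Lev} {y : ℤ} {tc : TCode} {g pi : ℕ} {tfix : Option ℤ} {d : IDom}
    (h : L.mkDom lev y tc g pi tfix = some d) :
    d.K0 = L.K0 ∧ d.fixed = L.fixed ∧ d.hasT = true := by
  unfold mkDom at h
  cases tfix <;>
  · simp only at h
    split at h
    · simp at h
    · split at h
      · split at h
        · simp at h
        · simp only [Option.some.injEq] at h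
          subst h
          exact ⟨rfl, rfl, rfl⟩
      · simp at h

/-- WHAT A LISTED CLASS LOOKS LIKE: the requested level/sign/letter, `g = gOf`, `π < g`, and a
domain of the law's shape. [cell] -/
theorem classesFor_mem {lev : Lev} {sgn q : ℤ} {tpar : Option ℕ} {tfix : Option ℤ} {c : GCls}
    (h : c ∈ L.classesFor lev sgn q tpar tfix) :
    c.lev = lev ∧ c.sgn = sgn ∧ c.q = q ∧ c.g = L.gOf lev c.tc ∧ c.pi < c.g ∧
      c.dom.K0 = L.K0 ∧ c.dom.fixed = L.fixed ∧ c.dom.hasT = true := by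
  unfold classesFor at h
  simp only [List.mem_flatMap, List.mem_filterMap, List.mem_range] at h
  obtain ⟨tc, -, pi, hpi, hc⟩ := h
  have hc' : (L.mkDom lev (sgn * q) tc (L.gOf lev tc) pi tfix).map
      (fun d => (⟨lev, sgn, q, tc, L.gOf lev tc, pi, d⟩ : GCls)) = some c := by
    revert hc
    cases tpar <;> dsimp only <;> split <;> intro hc <;> first | exact hc | simp at hc
  clear hc
  cases hmk : L.mkDom lev (sgn * q) tc (L.gOf lev tc) pi tfix with
  | none => rw [hmk] at hc'; simp at hc'
  | some d =>
    rw [hmk] at hc'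
    simp only [Option.map_some, Option.some.injEq] at hc'
    subst hc'
    obtain ⟨h1, h2, h3⟩ := L.mkDom_shape hmk
    exact ⟨rfl, rfl, rfl, rfl, hpi, h1, h2, h3⟩

/-- `4·⌈x/4⌉ ≤ x + 3` and `4·⌊x/4⌋ ≥ x - 3`, `2·⌈x/2⌉ ≥ x`, `2·⌊x/2⌋ ≤ x` (integer division).
[folklore] -/
theorem ceilDiv_bounds (x : ℤ) :
    x ≤ 4 * ceilDiv x 4 ∧ 4 * ceilDiv x 4 ≤ x + 3 ∧ x - 3 ≤ 4 * (x / 4) ∧ 4 * (x / 4) ≤ x ∧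
      x ≤ 2 * ceilDiv x 2 ∧ 2 * (x / 2) ≤ x := by
  unfold ceilDiv; omega

/-- MEANING OF THE `s`-INTERVAL OF A CLASS: every `s` in it gives a parameter `T` in the class's
`T`-interval with `g·T + π = 4s + r`. [cell] -/
theorem sIv_sound {r : ℕ} (hr : r < 4) {c : GCls} (hpi : c.pi < c.g) {AB : AForm × AForm}
    (h : sIv r c = some AB) {K s : ℤ} (hlo : AB.1.eval K 0 ≤ s) (hhi : s ≤ AB.2.eval K 0) :
    ∃ T : ℤ, c.dom.L0 + c.dom.L1 * K ≤ T ∧ T ≤ c.dom.U0 + c.dom.U1 * K ∧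
      (c.g : ℤ) * T + c.pi = 4 * s + r := by
  unfold sIv at h
  split at h
  · simp at h
  · rename_i hres
    have hres' : c.pi % c.g = r % c.g := by
      by_contra hne
      exact hres hne
    split at h
    · rename_i hg
      simp only [Option.some.injEq] at h
      subst h
      simp only [eval, zero_mul, add_zero] at hlo hhi
      have hpr : c.pi = r := by rw [hg] at hres' hpi; omega
      refine ⟨s, hlo, hhi, ?_⟩
      rw [hpr, hg]; push_cast; ring
    · split at h
      · rename_i hg
        simp only at h
        split at h
        · simp at h
        · rename_i hpar
          simp only [not_or, not_not] at hpar
          obtain ⟨hL1, hU1⟩ := hpar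
          simp only [Option.some.injEq] at h
          subst h
          simp only [eval, zero_mul, add_zero] at hlo hhi
          set cc : ℤ := (((r : ℤ) - c.pi) / 2) % 2 with hcc
          have hcr : 2 * cc + c.pi = r := by rw [hg] at hres' hpi; omega
          have h4L : 2 * (c.dom.L1 / 2) = c.dom.L1 := by omega
          have h4U : 2 * (c.dom.U1 / 2) = c.dom.U1 := by omega
          obtain ⟨-, -, -, -, hc2, -⟩ := ceilDiv_bounds (c.dom.L0 - cc)
          obtain ⟨-, -, -, -, -, hf2⟩ := ceilDiv_bounds (c.dom.U0 - cc)
          refine ⟨2 * s + cc, ?_, ?_, ?_⟩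
          · have : 2 * (ceilDiv (c.dom.L0 - cc) 2 + c.dom.L1 / 2 * K) ≤ 2 * s := by linarith
            have e : 2 * (ceilDiv (c.dom.L0 - cc) 2 + c.dom.L1 / 2 * K) =
                2 * ceilDiv (c.dom.L0 - cc) 2 + 2 * (c.dom.L1 / 2) * K := by ring
            rw [e, h4L] at this
            linarith
          · have : 2 * s ≤ 2 * ((c.dom.U0 - cc) / 2 + c.dom.U1 / 2 * K) := by linarith
            have e : 2 * ((c.dom.U0 - cc) / 2 + c.dom.U1 / 2 * K) =
                2 * ((c.dom.U0 - cc) / 2) + 2 * (c.dom.U1 / 2) * K := by ring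
            rw [e, h4U] at this
            linarith
          · rw [hg]; push_cast; linarith
      · simp at h

/-- SOUNDNESS OF THE COVERAGE CHECK: every trailing significand of the level, at every admissible
`K`, is a member `t = g·T + π` of some served class, at a parameter of its domain. [cell] -/
theorem coverOK_sound {lev : Lev} {sgn q : ℤ} (h : L.coverOK lev sgn q = true) {K : ℤ}
    (hK : L.K0 ≤ K) (hfix : L.fixed = true → K = L.K0) {t : ℤ}
    (htlo : (L.trange lev).1.eval K 0 ≤ t) (hthi : t ≤ (L.trange lev).2.eval K 0)
    (htop : lev = Lev.top → t = 0) :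
    ∃ c ∈ L.mainClasses lev sgn q, ∃ T : ℤ, c.dom.mem K T ∧ (c.g : ℤ) * T + c.pi = t := by
  have ht0 : 0 ≤ t := by
    cases lev <;> simp only [trange, eval, const] at htlo <;> linarith
  obtain ⟨s, r, hr4, hts⟩ : ∃ s : ℤ, ∃ r : ℕ, r < 4 ∧ t = 4 * s + r :=
    ⟨t / 4, (t % 4).toNat, by omega, by omega⟩
  have hs0 : 0 ≤ s := by omega
  unfold coverOK at h
  simp only [List.all_eq_true, List.mem_range] at h
  have hr := h r hr4
  by_cases hesc : lev = Lev.top ∧ r ≠ 0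
  · exfalso
    have := htop hesc.1
    omega
  rw [if_neg hesc] at hr
  simp only [Bool.and_eq_true, decide_eq_true_eq] at hr
  obtain ⟨⟨hb1, hb2⟩, hchain⟩ := hr
  have hd := kDom_mem (fixed := L.fixed) hK hfix
  obtain ⟨-, hc4, -, -, -, -⟩ := ceilDiv_bounds ((L.trange lev).1.a - r)
  obtain ⟨-, -, hf4, -, -, -⟩ := ceilDiv_bounds ((L.trange lev).2.a - r)
  have h4lo : 4 * ((L.trange lev).1.b / 4) = (L.trange lev).1.b := by omega
  have h4hi : 4 * ((L.trange lev).2.b / 4) = (L.trange lev).2.b := by omega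
  simp only [eval, mul_zero, add_zero] at htlo hthi
  obtain ⟨AB, hAB, hA, hB⟩ := coverChain_sound hchain hd s
    (by
      split
      · rename_i htp
        simp only [eval, const, zero_mul, mul_zero, add_zero]
        have := htop htp
        omega
      · simp only [eval, mul_zero, add_zero]
        have : 4 * (ceilDiv ((L.trange lev).1.a - r) 4 + (L.trange lev).1.b / 4 * K) ≤
            4 * s + 3 := by
          have e : 4 * (ceilDiv ((L.trange lev).1.a - r) 4 + (L.trange lev).1.b / 4 * K) =
              4 * ceilDiv ((L.trange lev).1.a - r) 4 + 4 * ((L.trange lev).1.b / 4) * K := by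
            ring
          rw [e, h4lo]
          linarith
        omega)
    (by
      split
      · rename_i htp
        simp only [eval, const, zero_mul, mul_zero, add_zero]
        have := htop htp
        omega
      · simp only [eval, mul_zero, add_zero]
        have : 4 * s - 3 ≤ 4 * (((L.trange lev).2.a - r) / 4 + (L.trange lev).2.b / 4 * K) := by
          have e : 4 * (((L.trange lev).2.a - r) / 4 + (L.trange lev).2.b / 4 * K) =
              4 * (((L.trange lev).2.a - r) / 4) + 4 * ((L.trange lev).2.b / 4) * K := by ring
          rw [e, h4hi]
          linarith
        omega)
  rw [(List.perm_insertionSort _ _).mem_iff, List.mem_filterMap] at hAB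
  obtain ⟨c, hc, hcAB⟩ := hAB
  obtain ⟨-, -, -, -, hpi, hK0, hfx, hT⟩ := L.classesFor_mem hc
  obtain ⟨T, hT1, hT2, hres⟩ := sIv_sound hr4 hpi hcAB hA hB
  refine ⟨c, hc, T, ⟨?_, ?_, fun _ => ⟨hT1, hT2⟩, fun hf => ?_⟩, by rw [hres, hts]⟩
  · rw [hfx, hK0]; exact hfix
  · rw [hK0]; exact hK
  · rw [hT] at hf; exact absurd hf (by decide)

end LawData

end ThetaLaw

end MiniFloat

end Literature.ComputerArithmetic.FloatingPoint
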